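import Mathlib
import Summits.AtomisticToContinuum.Crystallization.Theorems.BraggSlacknessRigidityHcpDiffractionRigidityTemplateLatticeSplitAux2

/-!
# Template lattices are split — Aux file 4: the layer plane and the vertical period
# (crux `HcpDiffractionRigidity`, item `stmt-AtomisticToContinuum-13166`,
# stub `stub_templateLatticeSplit`, B2c₁ᵦ)

Let `N ⊆ ℝ³` be a `ℤ`-module spanning `ℝ³` whose Euclidean form splits as
`⟨z, z'⟩ = a² A(z,z') + h² λ(z) λ(z')` with a symmetric biadditive `ℚ`-form `A` whose diagonal
values are in-layer template values `(I² + IJ + J²)/9` and an additive `λ : N →+ ℤ` (Aux file 3).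
Using the integral Gram–Schmidt steps and the 2-adic corollary `no_three_orthogonal` of Aux file 2
we show (`exists_layer_normal`):

* `λ ≠ 0` (otherwise three `A`-orthogonal lattice vectors contradict `no_three_orthogonal`);
* there is `v ∈ N` with `λ(v) ≠ 0`, `A`-orthogonal to two independent vectors `f₁, f₂` of
  `ker λ`; then `A(v,v) = 0` (again by `no_three_orthogonal`), i.e. `|v|² = h² λ(v)²`, and
  `v ⊥ ker λ` (an element of `ker λ` which is `A`-orthogonal to `f₁, f₂` vanishes).

Registered helper stub: `stub_templateLatticeSplit_normal`.  All `[folklore]`.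
-/

noncomputable section

namespace Summit.AtomisticToContinuum.Crystallization.Theorems

namespace HcpRigiditySplit

open scoped BigOperators Real RealInnerProductSpace

/-! ## Linear-algebra preliminaries in `ℝ³` -/

/-- A set spanning `ℝ³` is not orthogonal to a non-zero vector. [folklore] -/
theorem exists_inner_ne_zero {N : Submodule ℤ (EuclideanSpace ℝ (Fin 3))}
    (hNs : Submodule.span ℝ (N : Set (EuclideanSpace ℝ (Fin 3))) = ⊤)
    {y : EuclideanSpace ℝ (Fin 3)} (hy : y ≠ 0) : ∃ z ∈ N, ⟪z, y⟫ ≠ 0 := by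
  by_contra hcon
  push Not at hcon
  have h1 : (N : Set (EuclideanSpace ℝ (Fin 3))) ⊆
      ((ℝ ∙ y)ᗮ : Submodule ℝ (EuclideanSpace ℝ (Fin 3))) := fun z hz =>
    Submodule.mem_orthogonal_singleton_iff_inner_left.2 (hcon z hz)
  have h2 : y ∈ (ℝ ∙ y)ᗮ := by
    have h3 : (⊤ : Submodule ℝ (EuclideanSpace ℝ (Fin 3))) ≤ (ℝ ∙ y)ᗮ := by
      rw [← hNs]; exact Submodule.span_le.2 h1
    exact h3 Submodule.mem_top
  rw [Submodule.mem_orthogonal_singleton_iff_inner_left] at h2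
  exact hy (inner_self_eq_zero.1 h2)

/-- Two vectors of `ℝ³` have a common non-zero normal vector. [folklore] -/
theorem exists_normal (p q : EuclideanSpace ℝ (Fin 3)) :
    ∃ y : EuclideanSpace ℝ (Fin 3), y ≠ 0 ∧ ⟪p, y⟫ = 0 ∧ ⟪q, y⟫ = 0 := by
  set S : Submodule ℝ (EuclideanSpace ℝ (Fin 3)) :=
    Submodule.span ℝ (↑({p, q} : Finset (EuclideanSpace ℝ (Fin 3)))) with hS
  have h1 : Module.finrank ℝ S ≤ 2 := by
    have := finrank_span_finset_le_card (R := ℝ) ({p, q} : Finset (EuclideanSpace ℝ (Fin 3)))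
    exact this.trans Finset.card_le_two
  have h2 := Submodule.finrank_add_finrank_orthogonal S
  rw [finrank_euclideanSpace_fin] at h2
  have h3 : Sᗮ ≠ ⊥ := by
    rw [← Submodule.one_le_finrank_iff]
    omega
  obtain ⟨y, hy, hy0⟩ := Submodule.exists_mem_ne_zero_of_ne_bot h3
  have hp : p ∈ S := Submodule.subset_span (by simp)
  have hq : q ∈ S := Submodule.subset_span (by simp)
  exact ⟨y, hy0, Submodule.inner_right_of_mem_orthogonal hp hy,
    Submodule.inner_right_of_mem_orthogonal hq hy⟩

/-- `⟨c z − d w, y⟩ = c⟨z, y⟩ − d⟨w, y⟩` for integer multiples. [folklore] -/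
theorem inner_zsmul_sub (z w y : EuclideanSpace ℝ (Fin 3)) (c d : ℤ) :
    ⟪c • z - d • w, y⟫ = c * ⟪z, y⟫ - d * ⟪w, y⟫ := by
  rw [← Int.cast_smul_eq_zsmul ℝ c, ← Int.cast_smul_eq_zsmul ℝ d, inner_sub_left,
    real_inner_smul_left, real_inner_smul_left]

/-- `⟨C z − c₁ f₁ − c₂ f₂, y⟩ = C⟨z, y⟩ − c₁⟨f₁, y⟩ − c₂⟨f₂, y⟩`. [folklore] -/
theorem inner_zsmul_sub_sub (z f₁ f₂ y : EuclideanSpace ℝ (Fin 3)) (C c₁ c₂ : ℤ) :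
    ⟪C • z - c₁ • f₁ - c₂ • f₂, y⟫ = C * ⟪z, y⟫ - c₁ * ⟪f₁, y⟫ - c₂ * ⟪f₂, y⟫ := by
  rw [inner_sub_left, inner_zsmul_sub, ← Int.cast_smul_eq_zsmul ℝ c₂, real_inner_smul_left]

/-! ## The split Gram pencil: first consequences -/

section Pencil

variable {a h : ℝ} {N : Submodule ℤ (EuclideanSpace ℝ (Fin 3))} {A : N →+ N →+ ℚ} {lam : N →+ ℤ}

/-- Diagonal values of the in-layer form are non-negative. [folklore] -/
theorem formA_nonneg (hval : ∀ z : N, ∃ I J : ℤ, A z z = ((I : ℚ) ^ 2 + I * J + J ^ 2) / 9)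
    (z : N) : 0 ≤ A z z := by
  obtain ⟨I, J, hz⟩ := hval z
  rw [hz]
  exact div_nonneg (loeschian_nonneg I J) (by norm_num)

/-- On the kernel of the layer index the Euclidean form is `a² A`. [folklore] -/
theorem inner_of_ker
    (hinner : ∀ z z' : N, ⟪(z : EuclideanSpace ℝ (Fin 3)), z'⟫ =
      a ^ 2 * ((A z z' : ℚ) : ℝ) + h ^ 2 * ((lam z : ℤ) : ℝ) * ((lam z' : ℤ) : ℝ))
    {u : N} (hu : lam u = 0) (w : N) :
    ⟪(u : EuclideanSpace ℝ (Fin 3)), w⟫ = a ^ 2 * ((A u w : ℚ) : ℝ) := by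
  rw [hinner, hu]
  simp

/-- A non-zero kernel vector has positive in-layer length. [folklore] -/
theorem formA_pos_of_ker (ha : a ≠ 0)
    (hinner : ∀ z z' : N, ⟪(z : EuclideanSpace ℝ (Fin 3)), z'⟫ =
      a ^ 2 * ((A z z' : ℚ) : ℝ) + h ^ 2 * ((lam z : ℤ) : ℝ) * ((lam z' : ℤ) : ℝ))
    {z : N} (hz : lam z = 0) (hz0 : z ≠ 0) : 0 < A z z := by
  have h1 := inner_of_ker hinner hz z
  rw [real_inner_self_eq_norm_sq] at h1
  have h2 : (z : EuclideanSpace ℝ (Fin 3)) ≠ 0 := fun h0 => hz0 (by exact_mod_cast h0)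
  have h3 : 0 < ‖(z : EuclideanSpace ℝ (Fin 3))‖ ^ 2 := by positivity
  rw [h1] at h3
  have ha2 : (0 : ℝ) < a ^ 2 := by positivity
  exact_mod_cast (mul_pos_iff_of_pos_left ha2).1 h3

/-- `18 A(z, z') ∈ ℤ`: polarisation of the diagonal values `(I² + IJ + J²)/9`. [folklore] -/
theorem exists_int_eighteen_mul (hsymm : ∀ z z' : N, A z z' = A z' z)
    (hval : ∀ z : N, ∃ I J : ℤ, A z z = ((I : ℚ) ^ 2 + I * J + J ^ 2) / 9) (z z' : N) :
    ∃ n : ℤ, 18 * A z z' = n := by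
  obtain ⟨I₁, J₁, h₁⟩ := hval (z + z')
  obtain ⟨I₂, J₂, h₂⟩ := hval z
  obtain ⟨I₃, J₃, h₃⟩ := hval z'
  refine ⟨(I₁ ^ 2 + I₁ * J₁ + J₁ ^ 2) - (I₂ ^ 2 + I₂ * J₂ + J₂ ^ 2) -
    (I₃ ^ 2 + I₃ * J₃ + J₃ ^ 2), ?_⟩
  simp only [map_add, AddMonoidHom.add_apply, hsymm z' z] at h₁
  push_cast
  linear_combination 9 * h₁ - 9 * h₂ - 9 * h₃

/-! ## The layer index is non-trivial -/

/-- **`λ ≠ 0`.** If the layer index vanished identically, three probes of the spanning module `N`,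
made `A`-orthogonal by integral Gram–Schmidt, would be three `A`-orthogonal vectors of positive
in-layer length, contradicting `no_three_orthogonal`. [folklore] -/
theorem exists_lam_ne_zero (ha : a ≠ 0)
    (hNs : Submodule.span ℝ (N : Set (EuclideanSpace ℝ (Fin 3))) = ⊤)
    (hsymm : ∀ z z' : N, A z z' = A z' z)
    (hinner : ∀ z z' : N, ⟪(z : EuclideanSpace ℝ (Fin 3)), z'⟫ =
      a ^ 2 * ((A z z' : ℚ) : ℝ) + h ^ 2 * ((lam z : ℤ) : ℝ) * ((lam z' : ℤ) : ℝ))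
    (hval : ∀ z : N, ∃ I J : ℤ, A z z = ((I : ℚ) ^ 2 + I * J + J ^ 2) / 9) :
    ∃ v₀ : N, lam v₀ ≠ 0 := by
  by_contra hcon
  push Not at hcon
  -- first vector
  obtain ⟨y₁, hy₁⟩ : ∃ y : (EuclideanSpace ℝ (Fin 3)), y ≠ 0 := exists_ne 0
  obtain ⟨z₁, hz₁N, hz₁⟩ := exists_inner_ne_zero hNs hy₁
  set f₁ : N := ⟨z₁, hz₁N⟩ with hf₁def
  have hf₁0 : f₁ ≠ 0 := by
    intro h0
    apply hz₁
    rw [show z₁ = (f₁ : EuclideanSpace ℝ (Fin 3)) from rfl, h0, Submodule.coe_zero,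
      inner_zero_left]
  have hA₁ : 0 < A f₁ f₁ := formA_pos_of_ker ha hinner (hcon f₁) hf₁0
  -- second vector
  obtain ⟨y₂, hy₂0, hy₂, -⟩ := exists_normal f₁ f₁
  obtain ⟨z₂, hz₂N, hz₂⟩ := exists_inner_ne_zero hNs hy₂0
  obtain ⟨c, c₁, hc, hc₁⟩ := gramSchmidt_one A f₁ ⟨z₂, hz₂N⟩ hA₁.ne'
  set f₂ : N := c • (⟨z₂, hz₂N⟩ : N) - c₁ • f₁ with hf₂def
  have hf₂y : ⟪(f₂ : EuclideanSpace ℝ (Fin 3)), y₂⟫ = c * ⟪z₂, y₂⟫ := by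
    rw [hf₂def, Submodule.coe_sub, Submodule.coe_smul, Submodule.coe_smul, inner_zsmul_sub, hy₂]
    simp
  have hf₂0 : f₂ ≠ 0 := by
    intro h0
    rw [h0, Submodule.coe_zero, inner_zero_left] at hf₂y
    exact mul_ne_zero (Int.cast_ne_zero.2 hc) hz₂ hf₂y.symm
  have hA₂ : 0 < A f₂ f₂ := formA_pos_of_ker ha hinner (hcon f₂) hf₂0
  -- third vector
  obtain ⟨y₃, hy₃0, hy₃₁, hy₃₂⟩ := exists_normal f₁ f₂
  obtain ⟨z₃, hz₃N, hz₃⟩ := exists_inner_ne_zero hNs hy₃0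
  obtain ⟨C, d₁, d₂, hC, hC₁, hC₂⟩ :=
    gramSchmidt_two A hsymm f₁ f₂ ⟨z₃, hz₃N⟩ hA₁.ne' hA₂.ne' hc₁
  set f₃ : N := C • (⟨z₃, hz₃N⟩ : N) - d₁ • f₁ - d₂ • f₂ with hf₃def
  have hf₃y : ⟪(f₃ : EuclideanSpace ℝ (Fin 3)), y₃⟫ = C * ⟪z₃, y₃⟫ := by
    rw [hf₃def, Submodule.coe_sub, Submodule.coe_sub, Submodule.coe_smul, Submodule.coe_smul,
      Submodule.coe_smul, inner_zsmul_sub_sub, hy₃₁, hy₃₂]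
    simp
  have hf₃0 : f₃ ≠ 0 := by
    intro h0
    rw [h0, Submodule.coe_zero, inner_zero_left] at hf₃y
    exact mul_ne_zero (Int.cast_ne_zero.2 hC) hz₃ hf₃y.symm
  have hA₃ : 0 < A f₃ f₃ := formA_pos_of_ker ha hinner (hcon f₃) hf₃0
  exact no_three_orthogonal A hsymm hval hc₁ hC₁ hC₂ hA₁ hA₂ hA₃

/-! ## Two in-layer vectors and an `A`-orthogonal interlayer vector -/

/-- **The Gram–Schmidt frame.** There are `f₁, f₂ ∈ ker λ` of positive in-layer length with
`A(f₁,f₂) = 0`, and `v` with `λ(v) ≠ 0` and `A(f₁,v) = A(f₂,v) = 0`. [folklore] -/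
theorem exists_frame (ha : a ≠ 0)
    (hNs : Submodule.span ℝ (N : Set (EuclideanSpace ℝ (Fin 3))) = ⊤)
    (hsymm : ∀ z z' : N, A z z' = A z' z)
    (hinner : ∀ z z' : N, ⟪(z : EuclideanSpace ℝ (Fin 3)), z'⟫ =
      a ^ 2 * ((A z z' : ℚ) : ℝ) + h ^ 2 * ((lam z : ℤ) : ℝ) * ((lam z' : ℤ) : ℝ))
    (hval : ∀ z : N, ∃ I J : ℤ, A z z = ((I : ℚ) ^ 2 + I * J + J ^ 2) / 9) :
    ∃ f₁ f₂ v : N, lam f₁ = 0 ∧ lam f₂ = 0 ∧ 0 < A f₁ f₁ ∧ 0 < A f₂ f₂ ∧ A f₁ f₂ = 0 ∧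
      lam v ≠ 0 ∧ A f₁ v = 0 ∧ A f₂ v = 0 := by
  obtain ⟨v₀, hv₀⟩ := exists_lam_ne_zero ha hNs hsymm hinner hval
  -- the projection `z ↦ λ(v₀) z − λ(z) v₀` onto `ker λ`
  have hκ : ∀ z : N, lam (lam v₀ • z - lam z • v₀) = 0 := fun z => by
    simp only [map_sub, map_zsmul, smul_eq_mul]
    ring
  have hκy : ∀ (z : N) (y : EuclideanSpace ℝ (Fin 3)), ⟪(v₀ : EuclideanSpace ℝ (Fin 3)), y⟫ = 0 →
      ⟪((lam v₀ • z - lam z • v₀ : N) : EuclideanSpace ℝ (Fin 3)), y⟫ =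
        lam v₀ * ⟪(z : EuclideanSpace ℝ (Fin 3)), y⟫ := by
    intro z y hy
    rw [Submodule.coe_sub, Submodule.coe_smul, Submodule.coe_smul, inner_zsmul_sub, hy]
    simp
  -- first kernel vector
  obtain ⟨y₁, hy₁0, hy₁, -⟩ := exists_normal v₀ v₀
  obtain ⟨z₁, hz₁N, hz₁⟩ := exists_inner_ne_zero hNs hy₁0
  set f₁ : N := lam v₀ • (⟨z₁, hz₁N⟩ : N) - lam (⟨z₁, hz₁N⟩ : N) • v₀ with hf₁def
  have hf₁ : lam f₁ = 0 := hκ _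
  have hf₁0 : f₁ ≠ 0 := by
    intro h0
    have h1 := hκy ⟨z₁, hz₁N⟩ y₁ hy₁
    rw [← hf₁def, h0, Submodule.coe_zero, inner_zero_left] at h1
    exact mul_ne_zero (Int.cast_ne_zero.2 hv₀) hz₁ h1.symm
  have hA₁ : 0 < A f₁ f₁ := formA_pos_of_ker ha hinner hf₁ hf₁0
  -- second kernel vector
  obtain ⟨y₂, hy₂0, hy₂v, hy₂f⟩ := exists_normal v₀ f₁
  obtain ⟨z₂, hz₂N, hz₂⟩ := exists_inner_ne_zero hNs hy₂0
  set u₂ : N := lam v₀ • (⟨z₂, hz₂N⟩ : N) - lam (⟨z₂, hz₂N⟩ : N) • v₀ with hu₂def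
  have hu₂ : lam u₂ = 0 := hκ _
  have hu₂y : ⟪(u₂ : EuclideanSpace ℝ (Fin 3)), y₂⟫ = lam v₀ * ⟪z₂, y₂⟫ := hκy ⟨z₂, hz₂N⟩ y₂ hy₂v
  obtain ⟨c, c₁, hc, hc₁⟩ := gramSchmidt_one A f₁ u₂ hA₁.ne'
  set f₂ : N := c • u₂ - c₁ • f₁ with hf₂def
  have hf₂ : lam f₂ = 0 := by
    simp only [hf₂def, map_sub, map_zsmul, hu₂, hf₁, smul_zero, sub_zero]
  have hf₂0 : f₂ ≠ 0 := by
    intro h0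
    have h1 : ⟪(f₂ : EuclideanSpace ℝ (Fin 3)), y₂⟫ = c * (lam v₀ * ⟪z₂, y₂⟫) := by
      rw [hf₂def, Submodule.coe_sub, Submodule.coe_smul, Submodule.coe_smul, inner_zsmul_sub,
        hu₂y, hy₂f]
      simp
    rw [h0, Submodule.coe_zero, inner_zero_left] at h1
    exact mul_ne_zero (Int.cast_ne_zero.2 hc) (mul_ne_zero (Int.cast_ne_zero.2 hv₀) hz₂) h1.symm
  have hA₂ : 0 < A f₂ f₂ := formA_pos_of_ker ha hinner hf₂ hf₂0
  -- the interlayer vector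
  obtain ⟨C, d₁, d₂, hC, hC₁, hC₂⟩ := gramSchmidt_two A hsymm f₁ f₂ v₀ hA₁.ne' hA₂.ne' hc₁
  refine ⟨f₁, f₂, C • v₀ - d₁ • f₁ - d₂ • f₂, hf₁, hf₂, hA₁, hA₂, hc₁, ?_, hC₁, hC₂⟩
  simp only [map_sub, map_zsmul, hf₁, hf₂, smul_eq_mul, mul_zero, sub_zero]
  exact mul_ne_zero hC hv₀

/-- **The interlayer vector is vertical and normal to the layer plane.** With `f₁, f₂, v` as in
`exists_frame`: `A(v,v) = 0` (otherwise `f₁, f₂, v` contradict `no_three_orthogonal`), and every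
`u ∈ ker λ` is Euclidean-orthogonal to `v` (Gram–Schmidt of `u` against `f₁, f₂` yields a kernel
vector `A`-orthogonal to both, which must vanish by `no_three_orthogonal`; and `fᵢ ⊥ v`).
[folklore] -/
theorem vertical_of_frame (ha : a ≠ 0) (hsymm : ∀ z z' : N, A z z' = A z' z)
    (hinner : ∀ z z' : N, ⟪(z : EuclideanSpace ℝ (Fin 3)), z'⟫ =
      a ^ 2 * ((A z z' : ℚ) : ℝ) + h ^ 2 * ((lam z : ℤ) : ℝ) * ((lam z' : ℤ) : ℝ))
    (hval : ∀ z : N, ∃ I J : ℤ, A z z = ((I : ℚ) ^ 2 + I * J + J ^ 2) / 9) {f₁ f₂ v : N}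
    (hf₁ : lam f₁ = 0) (hf₂ : lam f₂ = 0) (hA₁ : 0 < A f₁ f₁) (hA₂ : 0 < A f₂ f₂)
    (h₁₂ : A f₁ f₂ = 0) (h₁v : A f₁ v = 0) (h₂v : A f₂ v = 0) :
    A v v = 0 ∧ ∀ u : N, lam u = 0 → ⟪(u : EuclideanSpace ℝ (Fin 3)), v⟫ = 0 := by
  constructor
  · by_contra hne
    have hpos : 0 < A v v := lt_of_le_of_ne (formA_nonneg hval v) (Ne.symm hne)
    exact no_three_orthogonal A hsymm hval h₁₂ h₁v h₂v hA₁ hA₂ hpos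
  · intro u hu
    obtain ⟨C, d₁, d₂, hC, hC₁, hC₂⟩ := gramSchmidt_two A hsymm f₁ f₂ u hA₁.ne' hA₂.ne' h₁₂
    set u' : N := C • u - d₁ • f₁ - d₂ • f₂ with hu'def
    have hu' : lam u' = 0 := by
      simp only [hu'def, map_sub, map_zsmul, hu, hf₁, hf₂, smul_zero, sub_zero]
    have hu'0 : u' = 0 := by
      by_contra hne
      exact no_three_orthogonal A hsymm hval h₁₂ hC₁ hC₂ hA₁ hA₂
        (formA_pos_of_ker ha hinner hu' hne)
    have h1 : ⟪(f₁ : EuclideanSpace ℝ (Fin 3)), v⟫ = 0 := by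
      rw [inner_of_ker hinner hf₁, h₁v]; simp
    have h2 : ⟪(f₂ : EuclideanSpace ℝ (Fin 3)), v⟫ = 0 := by
      rw [inner_of_ker hinner hf₂, h₂v]; simp
    have h3 : ⟪(u' : EuclideanSpace ℝ (Fin 3)), v⟫ = C * ⟪(u : EuclideanSpace ℝ (Fin 3)), v⟫ := by
      rw [hu'def, Submodule.coe_sub, Submodule.coe_sub, Submodule.coe_smul, Submodule.coe_smul,
        Submodule.coe_smul, inner_zsmul_sub_sub, h1, h2]
      simp
    rw [hu'0, Submodule.coe_zero, inner_zero_left] at h3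
    have hC' : (C : ℝ) ≠ 0 := Int.cast_ne_zero.2 hC
    exact (mul_eq_zero.1 h3.symm).resolve_left hC'

/-- **The vertical period.** There is `v ∈ N` with `λ(v) ≠ 0`, `|v|² = h² λ(v)²`, and
`v ⊥ ker λ`. [folklore] -/
theorem exists_layer_normal (ha : a ≠ 0)
    (hNs : Submodule.span ℝ (N : Set (EuclideanSpace ℝ (Fin 3))) = ⊤)
    (hsymm : ∀ z z' : N, A z z' = A z' z)
    (hinner : ∀ z z' : N, ⟪(z : EuclideanSpace ℝ (Fin 3)), z'⟫ =
      a ^ 2 * ((A z z' : ℚ) : ℝ) + h ^ 2 * ((lam z : ℤ) : ℝ) * ((lam z' : ℤ) : ℝ))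
    (hval : ∀ z : N, ∃ I J : ℤ, A z z = ((I : ℚ) ^ 2 + I * J + J ^ 2) / 9) :
    ∃ v : N, lam v ≠ 0 ∧ ‖(v : EuclideanSpace ℝ (Fin 3))‖ ^ 2 = h ^ 2 * ((lam v : ℤ) : ℝ) ^ 2 ∧
      ∀ u : N, lam u = 0 → ⟪(u : EuclideanSpace ℝ (Fin 3)), v⟫ = 0 := by
  obtain ⟨f₁, f₂, v, hf₁, hf₂, hA₁, hA₂, h₁₂, hv, h₁v, h₂v⟩ :=
    exists_frame ha hNs hsymm hinner hval
  obtain ⟨hvv, hperp⟩ := vertical_of_frame ha hsymm hinner hval hf₁ hf₂ hA₁ hA₂ h₁₂ h₁v h₂v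
  refine ⟨v, hv, ?_, hperp⟩
  rw [← real_inner_self_eq_norm_sq, hinner, hvv]
  push_cast
  ring

end Pencil

end HcpRigiditySplit

/-- **Registered helper stub of `stub_templateLatticeSplit` (Aux file 4): the vertical period of
a split Gram pencil.** If a `ℤ`-module `N` spanning `ℝ³` has `⟨z, z'⟩ = a² A(z,z') + h² λ(z) λ(z')`
with `A` symmetric biadditive with in-layer diagonal values `(I² + IJ + J²)/9` and `λ : N →+ ℤ`
additive (`a ≠ 0`), then some `v ∈ N` has `λ(v) ≠ 0`, `|v|² = h² λ(v)²` and is orthogonal to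
`ker λ`. [folklore] -/
theorem stub_templateLatticeSplit_normal : ∀ (a h : ℝ), a ≠ 0 → ∀ N : Submodule ℤ (EuclideanSpace ℝ (Fin 3)), Submodule.span ℝ (N : Set (EuclideanSpace ℝ (Fin 3))) = ⊤ → ∀ (A : ↥N →+ ↥N →+ ℚ) (lam : ↥N →+ ℤ), (∀ z z' : ↥N, A z z' = A z' z) → (∀ z z' : ↥N, inner ℝ (z : EuclideanSpace ℝ (Fin 3)) (z' : EuclideanSpace ℝ (Fin 3)) = a ^ 2 * ((A z z' : ℚ) : ℝ) + h ^ 2 * ((lam z : ℤ) : ℝ) * ((lam z' : ℤ) : ℝ)) → (∀ z : ↥N, ∃ I J : ℤ, A z z = ((I : ℚ) ^ 2 + I * J + J ^ 2) / 9) → ∃ v : ↥N, lam v ≠ 0 ∧ ‖(v : EuclideanSpace ℝ (Fin 3))‖ ^ 2 = h ^ 2 * ((lam v : ℤ) : ℝ) ^ 2 ∧ ∀ u : ↥N, lam u = 0 → inner ℝ (u : EuclideanSpace ℝ (Fin 3)) (v : EuclideanSpace ℝ (Fin 3)) = 0 :=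
  fun _ _ ha _ hNs _ _ hsymm hinner hval =>
    HcpRigiditySplit.exists_layer_normal ha hNs hsymm hinner hval

end Summit.AtomisticToContinuum.Crystallization.Theorems
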